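import Literature.Analysis.FluidPDE.BallisticFreeEnergyCoercivity
import HarnessLib

/-!
# BF18 shell for functions (crux `ChaosClosesEuler`, stmt-AtomisticToContinuum-15141, line `Sketch`,
# stub `stub_bf18Shell`) — helper 5: the relative thermal energy is uniformly small near the diagonal

WHAT. `relEnergyThermo_small_near_diag`: for an equation of state with continuous constitutive functions on the
open quadrant (`IsGibbs`) and a compact `K ⊂ (0,∞)²` of reference states, for every `κ > 0` there is `η > 0`
such that `R(ρ, ϑ | r, Θ) ≤ κ` whenever `(r, Θ) ∈ K`, `|ρ − r| ≤ η`, `|ϑ − Θ| ≤ η` (BF's relative thermal energy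
`R = H_Θ(ρ,ϑ) − ∂_ρH_Θ(r,Θ)(ρ−r) − H_Θ(r,Θ)` vanishes on the diagonal and is jointly continuous, hence
uniformly continuous on a compact neighbourhood of the diagonal over `K`).

WHY. The shell starts its Grönwall from the sup-closeness (H5) of the field to the classical data at `t = 0`;
near the reference state the entropy clamp is inactive and the clamped relative energy is
`|m − ρU|²/(2ρ) + R(ρ,ϑ | r,Θ)`, so the initial relative energy is `≤ ω(δ) → 0` — a modulus, which is all the
`∃ δ` of the shell needs (no rate).

No named fact is invoked.
-/

noncomputable section

namespace Summit.AtomisticToContinuum.HydrodynamicLimit.Theorems.ChaosClosesEulerShell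

open Set Metric
open scoped Topology
open Literature.Analysis.FluidPDE Literature.Analysis.FluidPDE.CompressibleEuler
open Literature.Analysis.FluidPDE.CompressibleEuler.EulerEOS

variable {eos : EulerEOS}

/-- `R(ρ,ϑ | r,Θ)` as a function of `((r,Θ),(ρ,ϑ))` is continuous on `(0,∞)² × (0,∞)²`. [folklore] -/
theorem continuousOn_relEnergyThermo₄ (hG : eos.IsGibbs) :
    ContinuousOn (fun q : (ℝ × ℝ) × (ℝ × ℝ) => eos.relEnergyThermo q.1.1 q.1.2 q.2.1 q.2.2)
      ((Ioi 0 ×ˢ Ioi 0) ×ˢ (Ioi 0 ×ˢ Ioi 0)) := by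
  have he : ContinuousOn (fun z : ℝ × ℝ => eos.e z.1 z.2) (Ioi 0 ×ˢ Ioi 0) := hG.2.1.continuousOn
  have hs : ContinuousOn (fun z : ℝ × ℝ => eos.s z.1 z.2) (Ioi 0 ×ˢ Ioi 0) := hG.2.2.1.continuousOn
  have hμ := hG.continuousOn_chemPotential
  have hHd := hG.continuousOn_ballisticFreeEnergy_diag
  -- the maps into the quadrant
  have m1 : MapsTo (fun q : (ℝ × ℝ) × (ℝ × ℝ) => q.1) ((Ioi 0 ×ˢ Ioi 0) ×ˢ (Ioi 0 ×ˢ Ioi 0))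
      (Ioi 0 ×ˢ Ioi 0) := fun q hq => hq.1
  have m2 : MapsTo (fun q : (ℝ × ℝ) × (ℝ × ℝ) => q.2) ((Ioi 0 ×ˢ Ioi 0) ×ˢ (Ioi 0 ×ˢ Ioi 0))
      (Ioi 0 ×ˢ Ioi 0) := fun q hq => hq.2
  have he₂ : ContinuousOn (fun q : (ℝ × ℝ) × (ℝ × ℝ) => eos.e q.2.1 q.2.2)
      ((Ioi 0 ×ˢ Ioi 0) ×ˢ (Ioi 0 ×ˢ Ioi 0)) := he.comp continuousOn_snd m2
  have hs₂ : ContinuousOn (fun q : (ℝ × ℝ) × (ℝ × ℝ) => eos.s q.2.1 q.2.2)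
      ((Ioi 0 ×ˢ Ioi 0) ×ˢ (Ioi 0 ×ˢ Ioi 0)) := hs.comp continuousOn_snd m2
  have hμ₁ : ContinuousOn (fun q : (ℝ × ℝ) × (ℝ × ℝ) => eos.chemPotential q.1.1 q.1.2)
      ((Ioi 0 ×ˢ Ioi 0) ×ˢ (Ioi 0 ×ˢ Ioi 0)) := hμ.comp continuousOn_fst m1
  have hH₁ : ContinuousOn (fun q : (ℝ × ℝ) × (ℝ × ℝ) => eos.ballisticFreeEnergy q.1.2 q.1.1 q.1.2)
      ((Ioi 0 ×ˢ Ioi 0) ×ˢ (Ioi 0 ×ˢ Ioi 0)) := hHd.comp continuousOn_fst m1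
  have hΘ : ContinuousOn (fun q : (ℝ × ℝ) × (ℝ × ℝ) => q.1.2) ((Ioi 0 ×ˢ Ioi 0) ×ˢ (Ioi 0 ×ˢ Ioi 0)) :=
    continuousOn_snd.comp continuousOn_fst m1
  have hρ : ContinuousOn (fun q : (ℝ × ℝ) × (ℝ × ℝ) => q.2.1) ((Ioi 0 ×ˢ Ioi 0) ×ˢ (Ioi 0 ×ˢ Ioi 0)) :=
    continuousOn_fst.comp continuousOn_snd m2
  have hr : ContinuousOn (fun q : (ℝ × ℝ) × (ℝ × ℝ) => q.1.1) ((Ioi 0 ×ˢ Ioi 0) ×ˢ (Ioi 0 ×ˢ Ioi 0)) :=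
    continuousOn_fst.comp continuousOn_fst m1
  have heq : (fun q : (ℝ × ℝ) × (ℝ × ℝ) => eos.relEnergyThermo q.1.1 q.1.2 q.2.1 q.2.2) =
      fun q => (q.2.1 * eos.e q.2.1 q.2.2 - q.1.2 * (q.2.1 * eos.s q.2.1 q.2.2)) -
        eos.chemPotential q.1.1 q.1.2 * (q.2.1 - q.1.1) - eos.ballisticFreeEnergy q.1.2 q.1.1 q.1.2 := by
    funext q; rfl
  rw [heq]
  exact (((hρ.mul he₂).sub (hΘ.mul (hρ.mul hs₂))).sub (hμ₁.mul (hρ.sub hr))).sub hH₁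

/-- **The relative thermal energy is uniformly small near the diagonal over a compact set of reference
states.** [cite: BrezinaFeireisl2018, (3.3)] -/
theorem relEnergyThermo_small_near_diag (hG : eos.IsGibbs) {K : Set (ℝ × ℝ)} (hK : IsCompact K)
    (hKq : K ⊆ Ioi 0 ×ˢ Ioi 0) {κ : ℝ} (hκ : 0 < κ) :
    ∃ η : ℝ, 0 < η ∧ ∀ r Θ ρ ϑ : ℝ, (r, Θ) ∈ K → |ρ - r| ≤ η → |ϑ - Θ| ≤ η →
      eos.relEnergyThermo r Θ ρ ϑ ≤ κ := by
  obtain ⟨δ, hδ, hKδ⟩ := hK.exists_cthickening_subset_open isOpen_quadrant hKq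
  -- the compact neighbourhood of the diagonal over `K`
  set S : Set ((ℝ × ℝ) × (ℝ × ℝ)) := K ×ˢ cthickening δ K with hS
  have hSc : IsCompact S := hK.prod hK.cthickening
  have hSq : S ⊆ (Ioi 0 ×ˢ Ioi 0) ×ˢ (Ioi 0 ×ˢ Ioi 0) := prod_mono hKq hKδ
  have huc := hSc.uniformContinuousOn_of_continuous ((continuousOn_relEnergyThermo₄ hG).mono hSq)
  rw [Metric.uniformContinuousOn_iff] at huc
  obtain ⟨η₀, hη₀, hη₀'⟩ := huc κ hκ
  refine ⟨min (η₀ / 2) δ, lt_min (by linarith) hδ, fun r Θ ρ ϑ hrΘ hρ hϑ => ?_⟩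
  have hη₁ : min (η₀ / 2) δ ≤ η₀ / 2 := min_le_left _ _
  have hη₂ : min (η₀ / 2) δ ≤ δ := min_le_right _ _
  -- the two points of `S`
  have hx : ((r, Θ), (r, Θ)) ∈ S := ⟨hrΘ, self_subset_cthickening K hrΘ⟩
  have hy : ((r, Θ), (ρ, ϑ)) ∈ S :=
    ⟨hrΘ, mem_cthickening_of_abs_le hrΘ (hρ.trans hη₂) (hϑ.trans hη₂)⟩
  have hdist : dist ((r, Θ), (r, Θ)) ((r, Θ), (ρ, ϑ)) < η₀ := by
    rw [Prod.dist_eq, dist_self, Prod.dist_eq, Real.dist_eq, Real.dist_eq, abs_sub_comm r ρ,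
      abs_sub_comm Θ ϑ]
    have h1 : max |ρ - r| |ϑ - Θ| ≤ η₀ / 2 := max_le (hρ.trans hη₁) (hϑ.trans hη₁)
    have h2 : (0 : ℝ) ≤ max |ρ - r| |ϑ - Θ| := le_max_of_le_left (abs_nonneg _)
    rw [max_eq_right h2]
    linarith
  have h := hη₀' _ hx _ hy hdist
  rw [Real.dist_eq] at h
  simp only [relEnergyThermo_self, zero_sub, abs_neg] at h
  exact (le_abs_self _).trans h.le

/-- REGISTERED SUB-GOAL `stub_bf18ShellInitial` of the line `Sketch` (helper 5 of `stub_bf18Shell`): the relative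
thermal energy is uniformly small near the diagonal over a compact set of reference states.
[cite: BrezinaFeireisl2018, (3.3)] -/
theorem stub_bf18ShellInitial :
    ∀ (eos : EulerEOS), eos.IsGibbs → ∀ (K : Set (ℝ × ℝ)), IsCompact K → K ⊆ Set.Ioi 0 ×ˢ Set.Ioi 0 →
      ∀ κ : ℝ, 0 < κ → ∃ η : ℝ, 0 < η ∧ ∀ r Θ ρ ϑ : ℝ, (r, Θ) ∈ K → |ρ - r| ≤ η → |ϑ - Θ| ≤ η →
        eos.relEnergyThermo r Θ ρ ϑ ≤ κ :=
  fun _eos hG _K hK hKq _κ hκ => relEnergyThermo_small_near_diag hG hK hKq hκ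

end Summit.AtomisticToContinuum.HydrodynamicLimit.Theorems.ChaosClosesEulerShell
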